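import Literature.MathematicalPhysics.QuantumFieldTheory.Balaban1983to89.B5G183FreeRowSum

/-!
# `Balaban1983to89.B5Eq129CoshSupersolution` — T. Bałaban, *Propagators and renormalization transformations for lattice gauge theories. I*, Commun. Math.
# Phys. **95** (1984) 17–40 [Balaban1984PropagatorsI] p. 36 («… proving that the operator e^{−⟨q,x⟩}Δ_a e^{⟨q,x⟩} − Δ_a is a small perturbation of Δ_a for
# vectors q ∈ R^d sufficiently small») and Prop. 1.2 (1.110) p. 35 (the decay `e^{−δ₀|y−y′|}`), with [Balaban1985BackgroundPropagators] Thm 3.1 (3.42) p. 397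
# (`e^{−δ₀d(y,y′)}`): **THE `cosh` PRODUCT WEIGHT IS A SUPERSOLUTION OF THE FLAT SCALAR LATTICE LAPLACIAN, SECOND ORDER IN THE RATE — on the torus
# `Π_μ ℤ∕N_μ` (index `Fin d`), for `W_c(y) = Π_μ cosh(a·dist(c_μ − y_μ, N_μℤ))`: `Σ_ν[W_c(y+e_ν) + W_c(y−e_ν)] ≤ 2d·cosh a·W_c(y)`, hence
# `(m − 2d·t²(cosh a − 1))·W_c(y) ≤ ((L₀ + m)W_c)(y)` for `(L₀φ)(y) = Σ_ν t²[(φ y − φ(y−e_ν)) + (φ y − φ(y+e_ν))]`, and `W_c(c) = 1`, `W_c ≥ 1`** — stone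
# (D-MP) of the NE9 owner's SUP-NORM PROGRAMME storey (D) (plan v10 §5): the Agmon weight that `B9Eq342SupNormBootstrap.scalar_le_mul_of_supersolution` ∕
# `B9Eq342SupNormBootstrapWeighted` consume, in the `Fin d` convention and the `Δ_t` notation of `B5Eq129FreeResolventSupBound`

statement-level skeleton of published theorems with citation tags; proofs where landed; nothing here is a claim about the Yang–Mills mass gap

CITATION HEADER (lean-in-tree rule).  Audit cell `pub-balaban`, sub-cell `t4`, BINDER row NE9; filed by the row OWNER lineage `b2b-balaban-t4-ne9-p1` (gen 89).
This is a PORT to the index convention `Fin d` of pv15's `B5G183FreeRowSum` §3 (`weight_stencil`, `weight_centre`; seat `b2b-balaban-pv15`), whose 1-D step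
`cosh_circAbs_step` («`cosh(a·d(v+1)) + cosh(a·d(v−1)) ≤ 2cosh a·cosh(a·d(v))` on `ℤ∕P`») and `circAbs_val_eq` are USED BY NAME; CREDIT theirs.  Sources as
quoted VERBATIM in `B5G183FreeRowSum`'s header ([Balaban1984PropagatorsI] p. 35 (1.108)∕(1.110), p. 36 ll. 20–23) and in `B9Eq342SupNormBootstrap`
([Balaban1985BackgroundPropagators] Thm 3.1 (3.42)).  METHOD = textbook Agmon∕Combes–Thomas supersolution (Hislop–Sigal Ch. 3), nothing printed is a hypothesis.

WHY THIS FILE (plan v10 §5).  The decay storey (D) reads the two dominations of `B9Eq342SupNormBootstrap` against a weight `W` with `λW ≤ (L₀+m)W`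
(`B9Eq342SupNormBootstrapWeighted.norm_le_of_kato_bootstrap_weighted`).  The product `cosh` weight centred at the output site is such a `W` with
`λ = m − 2d·t²(cosh a − 1)` — SECOND order in `a` (a one-sided exponential weight loses a first-order term `∝ t²a` and would force `a ≲ m∕t²`, no decay per
block; the product `cosh` weight allows `a ≈ √(m∕d)∕t`, i.e. an `O(1)` rate per unit block of `t` fine sites).

WHAT IS PROVED (sorry-free; 0 `def`; [folklore]; the weight WRITTEN OUT as `Π_μ Real.cosh (a * circAbs (N μ) ((c μ − y μ).val))`).
* `add_unitVec_apply'` ∕ `sub_unitVec_apply'` — coordinates of `y ± e_ν` (index `Fin d`).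
* **`weight_stencil'`** — `Σ_ν[W_c(y+e_ν) + W_c(y−e_ν)] ≤ 2d·cosh a·W_c(y)`.
* **`weight_supersolution`** — `(m − 2d·t²(Real.cosh a − 1))·W_c(y) ≤ Σ_ν t²[(W_c y − W_c(y−e_ν)) + (W_c y − W_c(y+e_ν))] + m·W_c(y)` — the `hsup` binder of
  `scalar_le_mul_of_supersolution` ∕ `norm_le_of_kato_bootstrap_weighted` for the flat Laplacian of `B5Eq129FreeResolventSupBound`.
* `weight_factor_centre` (each factor `= 1` at the centre, hence `W_c(c) = 1`), `one_le_weight` (`1 ≤ W_c(y)`), `weight_pos` (`0 < W_c(y)`).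
HONEST SCOPE.  The weight and its stencil only; the rate∕radius bookkeeping (`λ ≥ m∕2` for `a ≤ …`), the lower bound `W_c(y) ≥ 2^{−d}e^{a·Σ_μ dist}` against block
distances and the transport to `TSite` are the instance's.  NOT summit progress (cell pub-balaban: NE9 NOT PRINTED ∕ NOT PROVED; «NE9 ⇐ the named binders»; row
WALLED ON A MODEL (O-NE9-1; #5 UNRULED); spine PROVED 0∕9; rung (B)+1 finite T⁴ — NOT infinite volume, NOT mass gap, NOT BetaPertH, NOT Clay).  HONEST DEPENDENCY
(cell line): continuum YM on T⁴ ⇐ BetaPertH ∧ nine spine estimates (0/9 proved); BetaPertH ⇐ (D1) ∧ (D4) ∧ CAP+tail; G-an2-4 gates asym, D1 and NE2/3/4.  NEW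
file importing `B5G183FreeRowSum` only; nothing modified.  Net new unproved facts: 0.
-/

noncomputable section

open scoped BigOperators

namespace Literature.MathematicalPhysics.QuantumFieldTheory.Balaban1983to89.B5Eq129CoshSupersolution

open B5Prop11Plancherel (Tor unitVec)
open B4TorusKernel.MultiPeriod (circAbs circAbs_nonneg)
open B5G183FreeRowSum (cosh_circAbs_step circAbs_val_eq)

variable {d : ℕ} (N : Fin d → ℕ) [hN : ∀ μ, NeZero (N μ)]

omit hN in
/-- coordinates of `y + e_ν` (index `Fin d`). [folklore] [cite: Balaban1984PropagatorsI, (1.21) p.21] -/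
theorem add_unitVec_apply' (y : Tor N) (ν μ : Fin d) : (y + unitVec N ν) μ = if μ = ν then y μ + 1 else y μ := by
  rw [Pi.add_apply, unitVec]
  split_ifs with h
  · subst h; rw [Pi.single_eq_same]
  · rw [Pi.single_eq_of_ne h, add_zero]

omit hN in
/-- coordinates of `y − e_ν` (index `Fin d`). [folklore] [cite: Balaban1984PropagatorsI, (1.21) p.21] -/
theorem sub_unitVec_apply' (y : Tor N) (ν μ : Fin d) : (y - unitVec N ν) μ = if μ = ν then y μ - 1 else y μ := by
  rw [Pi.sub_apply, unitVec]
  split_ifs with h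
  · subst h; rw [Pi.single_eq_same]
  · rw [Pi.single_eq_of_ne h, sub_zero]

/-- **THE PRODUCT `cosh`-WEIGHT IS A SUPERSOLUTION STENCIL-WISE** (index `Fin d`): for `W_c(y) = Π_μ cosh(a·dist(c_μ − y_μ, N_μℤ))`,
`Σ_ν[W_c(y+e_ν) + W_c(y−e_ν)] ≤ 2d·cosh a·W_c(y)` — pv15's `weight_stencil`, re-indexed. [cite: Balaban1984PropagatorsI, p.36, (1.110) p.35] -/
theorem weight_stencil' (a : ℝ) (c y : Tor N) :
    ∑ ν, ((∏ μ, Real.cosh (a * (circAbs (N μ) ((c μ - (y + unitVec N ν) μ : ZMod (N μ)).val) : ℝ)))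
        + ∏ μ, Real.cosh (a * (circAbs (N μ) ((c μ - (y - unitVec N ν) μ : ZMod (N μ)).val) : ℝ)))
      ≤ 2 * d * Real.cosh a * ∏ μ, Real.cosh (a * (circAbs (N μ) ((c μ - y μ : ZMod (N μ)).val) : ℝ)) := by
  set f : Fin d → ℝ := fun μ => Real.cosh (a * (circAbs (N μ) ((c μ - y μ : ZMod (N μ)).val) : ℝ)) with hf
  have key : ∀ ν,
      (∏ μ, Real.cosh (a * (circAbs (N μ) ((c μ - (y + unitVec N ν) μ : ZMod (N μ)).val) : ℝ)))
        + ∏ μ, Real.cosh (a * (circAbs (N μ) ((c μ - (y - unitVec N ν) μ : ZMod (N μ)).val) : ℝ))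
        ≤ 2 * Real.cosh a * ∏ μ, f μ := by
    intro ν
    have hP : 1 ≤ N ν := Nat.one_le_iff_ne_zero.mpr (NeZero.ne _)
    set z : ℤ := (((c ν - y ν : ZMod (N ν)).val : ℕ) : ℤ) with hz
    have hzc : ((z : ℤ) : ZMod (N ν)) = c ν - y ν := by
      rw [hz, Int.cast_natCast, ZMod.natCast_zmod_val]
    have hplus : ∀ μ ∈ Finset.univ.erase ν,
        Real.cosh (a * (circAbs (N μ) ((c μ - (y + unitVec N ν) μ : ZMod (N μ)).val) : ℝ)) = f μ := by
      intro μ hμ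
      rw [add_unitVec_apply', if_neg (Finset.ne_of_mem_erase hμ)]
    have hminus : ∀ μ ∈ Finset.univ.erase ν,
        Real.cosh (a * (circAbs (N μ) ((c μ - (y - unitVec N ν) μ : ZMod (N μ)).val) : ℝ)) = f μ := by
      intro μ hμ
      rw [sub_unitVec_apply', if_neg (Finset.ne_of_mem_erase hμ)]
    rw [← Finset.mul_prod_erase _ _ (Finset.mem_univ ν), ← Finset.mul_prod_erase _ _ (Finset.mem_univ ν),
      ← Finset.mul_prod_erase _ f (Finset.mem_univ ν), Finset.prod_congr rfl hplus, Finset.prod_congr rfl hminus,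
      add_unitVec_apply', if_pos rfl, sub_unitVec_apply', if_pos rfl]
    have hR : 0 ≤ ∏ μ ∈ Finset.univ.erase ν, f μ := Finset.prod_nonneg fun μ _ => (Real.cosh_pos _).le
    have e1 : circAbs (N ν) (((c ν - (y ν + 1) : ZMod (N ν)).val : ℕ) : ℤ) = circAbs (N ν) (z - 1) :=
      circAbs_val_eq _ _ (by push_cast; rw [hzc]; ring)
    have e2 : circAbs (N ν) (((c ν - (y ν - 1) : ZMod (N ν)).val : ℕ) : ℤ) = circAbs (N ν) (z + 1) :=
      circAbs_val_eq _ _ (by push_cast; rw [hzc]; ring)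
    have e0 : f ν = Real.cosh (a * (circAbs (N ν) z : ℝ)) := by rw [hf]
    rw [e1, e2, e0, ← add_mul, ← mul_assoc]
    have h1d := cosh_circAbs_step hP a z
    exact mul_le_mul_of_nonneg_right (by linarith) hR
  calc ∑ ν, ((∏ μ, Real.cosh (a * (circAbs (N μ) ((c μ - (y + unitVec N ν) μ : ZMod (N μ)).val) : ℝ)))
        + ∏ μ, Real.cosh (a * (circAbs (N μ) ((c μ - (y - unitVec N ν) μ : ZMod (N μ)).val) : ℝ)))
      ≤ ∑ _ν : Fin d, 2 * Real.cosh a * ∏ μ, f μ := Finset.sum_le_sum fun ν _ => key ν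
    _ = 2 * d * Real.cosh a * ∏ μ, f μ := by
        rw [Finset.sum_const, Finset.card_univ, Fintype.card_fin, nsmul_eq_mul]
        ring

/-- **THE `cosh` WEIGHT IS A SUPERSOLUTION OF THE FLAT LAPLACIAN, SECOND ORDER IN THE RATE**: with `λ = m − 2d·t²(cosh a − 1)`,
`λ·W_c(y) ≤ Σ_ν t²[(W_c y − W_c(y−e_ν)) + (W_c y − W_c(y+e_ν))] + m·W_c(y)` — the binder `hsup` of `B9Eq342SupNormBootstrap.scalar_le_mul_of_supersolution`
for `(L₀φ)(y) = Σ_ν t²[(φ y − φ(y−e_ν)) + (φ y − φ(y+e_ν))]`. [cite: Balaban1984PropagatorsI, p.36; Balaban1985BackgroundPropagators, Thm 3.1 (3.42) p.397] -/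
theorem weight_supersolution (a t m : ℝ) (c y : Tor N) :
    (m - 2 * d * t ^ 2 * (Real.cosh a - 1)) * ∏ μ, Real.cosh (a * (circAbs (N μ) ((c μ - y μ : ZMod (N μ)).val) : ℝ)) ≤
      ∑ ν, t ^ 2 * ((∏ μ, Real.cosh (a * (circAbs (N μ) ((c μ - y μ : ZMod (N μ)).val) : ℝ)) -
            ∏ μ, Real.cosh (a * (circAbs (N μ) ((c μ - (y - unitVec N ν) μ : ZMod (N μ)).val) : ℝ))) +
          (∏ μ, Real.cosh (a * (circAbs (N μ) ((c μ - y μ : ZMod (N μ)).val) : ℝ)) -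
            ∏ μ, Real.cosh (a * (circAbs (N μ) ((c μ - (y + unitVec N ν) μ : ZMod (N μ)).val) : ℝ)))) +
        m * ∏ μ, Real.cosh (a * (circAbs (N μ) ((c μ - y μ : ZMod (N μ)).val) : ℝ)) := by
  have hst := weight_stencil' N a c y
  set W0 := ∏ μ, Real.cosh (a * (circAbs (N μ) ((c μ - y μ : ZMod (N μ)).val) : ℝ)) with hW0
  set A : Fin d → ℝ := fun ν => ∏ μ, Real.cosh (a * (circAbs (N μ) ((c μ - (y + unitVec N ν) μ : ZMod (N μ)).val) : ℝ)) with hA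
  set B : Fin d → ℝ := fun ν => ∏ μ, Real.cosh (a * (circAbs (N μ) ((c μ - (y - unitVec N ν) μ : ZMod (N μ)).val) : ℝ)) with hB
  have hst' : ∑ ν, (A ν + B ν) ≤ 2 * d * Real.cosh a * W0 := hst
  have hsum : ∑ ν, t ^ 2 * ((W0 - B ν) + (W0 - A ν)) = t ^ 2 * (2 * d * W0) - t ^ 2 * ∑ ν, (A ν + B ν) := by
    rw [← Finset.mul_sum]
    have e : ∀ ν, (W0 - B ν) + (W0 - A ν) = 2 * W0 - (A ν + B ν) := fun ν => by ring
    simp only [e, Finset.sum_sub_distrib, Finset.sum_const, Finset.card_univ, Fintype.card_fin, nsmul_eq_mul]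
    ring
  show (m - 2 * d * t ^ 2 * (Real.cosh a - 1)) * W0 ≤ ∑ ν, t ^ 2 * ((W0 - B ν) + (W0 - A ν)) + m * W0
  rw [hsum]
  have ht : 0 ≤ t ^ 2 := sq_nonneg t
  nlinarith [mul_le_mul_of_nonneg_left hst' ht]

omit hN in
/-- each factor of the weight is `1` at the centre (so `W_c(c) = 1` by `Finset.prod_eq_one`; the product form is pv15's `weight_centre` for the index
`Fin (d+1)`). [folklore] [cite: Balaban1984PropagatorsI, p.36] -/
theorem weight_factor_centre (a : ℝ) (c : Tor N) (μ : Fin d) : Real.cosh (a * (circAbs (N μ) ((c μ - c μ : ZMod (N μ)).val) : ℝ)) = 1 := by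
  have h0 : circAbs (N μ) 0 = 0 := by unfold circAbs; simp
  rw [sub_self, ZMod.val_zero, Nat.cast_zero, h0, Int.cast_zero, mul_zero, Real.cosh_zero]

omit hN in
/-- `1 ≤ W_c(y)` (each factor is a `cosh`). [folklore] [cite: Balaban1984PropagatorsI, p.36] -/
theorem one_le_weight (a : ℝ) (c y : Tor N) : 1 ≤ ∏ μ, Real.cosh (a * (circAbs (N μ) ((c μ - y μ : ZMod (N μ)).val) : ℝ)) :=
  Finset.one_le_prod fun _ _ => Real.one_le_cosh _

omit hN in
/-- `0 < W_c(y)`. [folklore] [cite: Balaban1984PropagatorsI, p.36] -/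
theorem weight_pos (a : ℝ) (c y : Tor N) : 0 < ∏ μ, Real.cosh (a * (circAbs (N μ) ((c μ - y μ : ZMod (N μ)).val) : ℝ)) :=
  lt_of_lt_of_le one_pos (one_le_weight N a c y)

end Literature.MathematicalPhysics.QuantumFieldTheory.Balaban1983to89.B5Eq129CoshSupersolution

end
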